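import Summits.HodgeConjecture.HodgeConjecture.Theorems.Ring2HypothesesDescentMotivatedStarOperator
import Summits.HodgeConjecture.HodgeConjecture.Theorems.Ring2HypothesesDescentMotivatedPullbackLift
import Summits.HodgeConjecture.HodgeConjecture.Theorems.Ring2HypothesesDescentStandardBDischarged
import Literature.AlgebraicGeometry.HodgeTheory.MumfordCurveLemmaAffineHolds
import HarnessLib

/-!
# Ring 2 hypotheses, descent face — dictionary edges from Prop. 2.2: the parent node `MotivatedImpliesAlgebraic`
# (`A_mot = A` for all varieties) is EQUIVALENT to `B` for all varieties (b10); André's Thm. 0.5 modulo c17 alone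

research route conditional on HC_CM; not a corollary; Q11.4-sentence-2 already refuted in dim ≥ 3.
Cell `pub-hodge-ring2` (Hodge ladder STAGE 3), seat `ring2-b05` (binder row b05
`Ring2.Hypotheses.MotivatedImpliesAlgebraicAV`), gen 36. `HC_CM` (`Theses.RankFourFaces.CMAbelianHodge`) does
not occur in this file; nothing here proves a case of the Hodge conjecture; the rows b05 / b10 stay OPEN.

* §1 `exists_motivated_corrClassAction_eq_lefschetzInvolution` — Prop. 2.2 in the tree's `IsAlgebraicCorrespondence`
  vocabulary (complex orientations): `*_η = u^*` with `u ∈ A_motᵇ(X ⊗ X)_ℂ`.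
* §2 `standardConjectureBStar_of_motivatedClasses_le` — **`A_mot(X ⊗ X) = A(X ⊗ X) ⟹ B(X)`** in Kleiman's polarised
  `⋆`-form `StandardConjectureBStar n X η`, for every polarisation `η` (André §0.3: «cette notion se réduit à celle de
  cycle algébrique si … l'involution `*_L` est donnée par une correspondance algébrique», read backwards through
  Prop. 2.2); `standardConjectureB_of_motivatedImpliesAlgebraic`; and the dictionary equivalence
  **`motivatedImpliesAlgebraic_iff_standardConjectureB` : `Ring2.Hypotheses.MotivatedImpliesAlgebraic` (parent node of
  row b05) ↔ `B` for all smooth projective complex varieties (binder b10)** — «→» new (Prop. 2.2), «←» the tree's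
  discharged §2.1 remark (`Ring2.Hypotheses.motivatedImpliesAlgebraic_of_standardConjectureB_discharged`).
* §3 `Andre1996_deformation_of_globalInvariantCycles` — bookkeeping after the discharge of leaf (A3) (gen 36,
  `…PullbackLift`): André's deformation theorem `Andre1996_deformation` (c24) follows from Deligne's théorème de la
  partie fixe `deligne_globalInvariantCycles` (c17) ALONE ((A0) Mumford, (A1) Hironaka, (A3), (A5) are tree theorems).

No definition, no named fact, no sorry. References: Andre1996Motifs (§0.3 pp. 7–8, §2.1 p. 14, Prop. 2.2 p. 16,
Thm. 0.5 p. 8, §5.1 p. 25), Grothendieck1968 (§3 p. 196), Kleiman1968AlgebraicCycles (§1.4, 2A11).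
-/

noncomputable section

-- every declaration of this problem lives in `Summit.HodgeConjecture.HodgeConjecture.…` (summit = sub-problem)
set_option linter.dupNamespace false

open CategoryTheory AlgebraicGeometry MonoidalCategory CartesianMonoidalCategory
open Literature.AlgebraicTopology.SingularHomology Literature.Geometry.Kaehler
open Literature.AlgebraicGeometry Literature.AlgebraicGeometry.Motives
  Literature.AlgebraicGeometry.HodgeTheory

namespace Summit.HodgeConjecture.HodgeConjecture.Theorems

variable {n : ℕ} {X : SchemeOver ℂ} {η : complexBetti X 2}

/-! ## §1 Prop. 2.2 with the complex orientations -/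

/-- **`*_η` is a motivated correspondence** (André Prop. 2.2), in the shape of the tree's `IsAlgebraicCorrespondence`
(complex orientation family, `corrClassAction`): there is `u ∈ A_motᵇ(X ⊗ X)_ℂ` with `u^* = *_η : Hᵃ → Hᵇ`, `a + b = 2n`.
[cite: Andre1996Motifs, Prop. 2.2 (p. 16)] -/
theorem exists_motivated_corrClassAction_eq_lefschetzInvolution (hX : IsSmoothProjective n X)
    (hη : IsPolarizationClass n X η) {a b : ℕ} (hab : a + b = 2 * n) :
    ∃ u ∈ motivatedClasses (n + n) (X ⊗ X) b,
      corrClassAction (complexOrientationFamily (IsSmoothProjective.tensor_holds hX hX)) (complexOrientationFamily hX)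
        (show a + 2 * b = b + 2 * n by omega) (show b + a = 2 * n by omega) u =
      lefschetzInvolution hη.hasHardLefschetz hab := by
  obtain ⟨u, hu, h⟩ := lefschetzInvolution_mem_map_corrAction complexOrientationFamily hX hη hab
  exact ⟨u, hu, by rw [← corrAction_eq_corrClassAction complexOrientationFamily hX hX]; exact h⟩

/-! ## §2 `A_mot = A ⟹ B`, and the parent node is equivalent to `B(all)` -/

/-- **`A_mot(X ⊗ X)_ℂ ⊆ A(X ⊗ X)_ℂ ⟹ B(X)` for every polarisation** (André §0.3 / §2.1 remark read through Prop. 2.2: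
`*_η` is induced by a motivated class of `X ⊗ X`, which is algebraic by hypothesis).
[cite: Andre1996Motifs, §0.3 (pp. 7–8) and Prop. 2.2 (p. 16)] [cite: Grothendieck1968, §3 p. 196 (B(X))] -/
theorem standardConjectureBStar_of_motivatedClasses_le (hX : IsSmoothProjective n X) (η : complexBetti X 2)
    (hXX : ∀ p, motivatedClasses (n + n) (X ⊗ X) p ≤ algebraicClasses (X ⊗ X) p) :
    StandardConjectureBStar n X η := by
  intro hη a b hab
  obtain ⟨u, hu, h⟩ := exists_motivated_corrClassAction_eq_lefschetzInvolution hX hη hab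
  exact ⟨_, _, hasPoincareDuality_complexOrientationFamily _, hasPoincareDuality_complexOrientationFamily hX, b, a,
    _, _, u, hXX b hu, h⟩

/-- **`MotivatedImpliesAlgebraic ⟹ B(Z)` for every smooth projective complex `Z` and every class `η`** (the
`⋆`-form is vacuous for non-polarisation classes). [cite: Andre1996Motifs, §0.3 (pp. 7–8) and Prop. 2.2 (p. 16)] -/
theorem standardConjectureB_of_motivatedImpliesAlgebraic (h : Ring2.Hypotheses.MotivatedImpliesAlgebraic) (d : ℕ)
    (Z : SchemeOver ℂ) (η : complexBetti Z 2) (hZ : IsSmoothProjective d Z) : StandardConjectureBStar d Z η :=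
  standardConjectureBStar_of_motivatedClasses_le hZ η fun p ↦ h (IsSmoothProjective.tensor_holds hZ hZ) p

/-- **DICTIONARY EQUIVALENCE `MotivatedImpliesAlgebraic ⟺ B(all)`**: the parent node of row b05 (`A_mot(X) = A(X)` for
every smooth projective complex `X`, André's programme) is equivalent to binder b10 (Grothendieck's standard conjecture
of Lefschetz type, `⋆`-form, for every smooth projective complex variety). «→»: Prop. 2.2 (this gen); «←»: André's
§2.1 remark, discharged in the tree (`Ring2.Hypotheses.motivatedImpliesAlgebraic_of_standardConjectureB_discharged`).
Both sides remain OPEN. [cite: Andre1996Motifs, §0.3 (pp. 7–8), §2.1 remark following Déf. 1 (p. 14) and Prop. 2.2 (p. 16)]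
[cite: Grothendieck1968, §3 p. 196 (B(X))] -/
theorem motivatedImpliesAlgebraic_iff_standardConjectureB :
    Ring2.Hypotheses.MotivatedImpliesAlgebraic ↔
      ∀ (d : ℕ) (Z : SchemeOver ℂ) (η : complexBetti Z 2), IsSmoothProjective d Z → StandardConjectureBStar d Z η :=
  ⟨standardConjectureB_of_motivatedImpliesAlgebraic,
    Ring2.Hypotheses.motivatedImpliesAlgebraic_of_standardConjectureB_discharged⟩

/-! ## §3 Bookkeeping: André's deformation theorem modulo the théorème de la partie fixe alone -/

/-- **`c24 ⟸ c17`**: André's deformation theorem `Andre1996_deformation` (Thm. 0.5) follows from Deligne's global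
invariant cycle theorem `deligne_globalInvariantCycles` alone — the other four inputs of the tree's assembly
`Andre1996_deformation_holds_of` are theorems: (A0) `Mumford_curveLemma_affine_holds`, (A1)
`Hironaka1964_smoothCompactification_holds`, (A3) `Andre1996_exists_motivated_of_motivated_pullback_holds` (gen 36,
duality from Prop. 3.3), (A5) `Andre1996_motivatedClasses_pullback_holds` (gen 34, Prop. 2.1 (ii)).
[cite: Andre1996Motifs, Thm. 0.5 (p. 8) and §5.1 (p. 25)] -/
theorem Andre1996_deformation_of_globalInvariantCycles (hD : deligne_globalInvariantCycles) : Andre1996_deformation :=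
  Andre1996_deformation_holds_of_inputs Mumford_curveLemma_affine_holds Hironaka1964_smoothCompactification_holds hD

end Summit.HodgeConjecture.HodgeConjecture.Theorems

end
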